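import Literature.AnabelianGeometry.EtaleTheta.SettingModelCyclotomicCharacterTransport
import Literature.AnabelianGeometry.EtaleTheta.CyclotomeGaloisFixedPoints
import HarnessLib

/-!
# The χ-twisted module `Ẑ(χ)` of `G_{ℚ_p}` has NO invariants under any finite-index / open subgroup
# (proof-only junction of `SettingModelCyclotomicCharacter` with the tree's `H⁰(U, Ẑ(1)) = 0`)

Classical local algebra: J. Neukirch, *Algebraic Number Theory*, Ch. II Prop. (5.7) (i) (the roots of unity of a `p`-adic
field form a FINITE group) [cite: NeukirchANT1999, Ch. II Prop. (5.7) (i)]; S. Mochizuki,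
[EtTh] §1 p. 12 «`Δ_Θ (≅ Ẑ(1))`» [cite: MochizukiEtTh2009, §1 p.12].  abc-iut cell, layer L2, seat abc-iut-w5-d091 (gen 4);
R78 cluster, file F3 addendum 1.  PROOF-ONLY (no definition, no instance, no named fact): the classical property of
`Ẑ(1)` that distinguishes the χ-twisted model from the root model (where `G_{ℚ_p}` acts TRIVIALLY on `Δ_Θ`), transported
to the abstract `G_{ℚ_p}`-module `Ẑ(χ)` := (`Ẑ`, `σ ↦ χ(σ) ∈ Aut(Ẑ)`) of `SettingModelCyclotomicCharacter` along the
cluster's identification `cycloZHat p : Λ(ℚ̄_pˣ) ≃* Ẑ` (`cycloZHat_symm_chi`):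

* **`eq_one_of_forall_chi_apply_eq`** — `H⁰(U, Ẑ(χ)) = 1` for every subgroup `U ≤ G_{ℚ_p}` of FINITE INDEX: an
  element `z ∈ Ẑ` with `χ(σ) z = z` for all `σ ∈ U` is trivial (abc-iut's `cyclotome_algClosure_eq_one_of_finiteIndex`,
  `CyclotomeGaloisFixedPoints.lean`); `eq_one_of_forall_chi_apply_eq_of_isOpen` — the same for OPEN `U` (open ⇒ finite
  index in the compact `G_{ℚ_p}`); in particular (`U = ⊤`) `eq_one_of_forall_chi_apply_eq_top`.
(Non-triviality `χ ≠ 1` is the sequel `SettingModelCyclotomicCharacterNontrivial`.)  This is the input behind «conjugation of `Π^tp` on `Δ_Θ(modelχ) ≅ Ẑ(χ)` is non-trivial, with no fixed part on any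
open subgroup» (R78 integration, abc-iut-L6-d6).  Nothing of [EtTh] is asserted; no side is taken on [IUTchIII] Cor. 3.12;
a model is consistency evidence only.
-/

noncomputable section

open CategoryTheory ProfiniteGrp ProfiniteGrp.ProfiniteCompletion

namespace Literature.AnabelianGeometry.EtaleTheta.SettingModel

open Literature.AnabelianGeometry.SemiGraphs (GQp)

variable (p : ℕ) [Fact p.Prime]

/-! ### `H⁰(U, Ẑ(χ))` is trivial for `U` of finite index / open -/

/-- Componentwise reading of the Galois action on the cyclotome: the `n`-th component of `σ • ζ` is `σ(ζ_n)`.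
[cite: MochizukiEtTh2009, §1 p.12] -/
theorem coe_map_galUnits_apply (σ : GQp p) (ζ : cyclotome (PadicAlgCl p)ˣ) (n : ℕ+) :
    ((((cyclotome.map (galUnits p σ).toMonoidHom ζ : cyclotome (PadicAlgCl p)ˣ) : ℕ+ → (PadicAlgCl p)ˣ) n :
        (PadicAlgCl p)ˣ) : PadicAlgCl p) = σ ((((ζ : ℕ+ → (PadicAlgCl p)ˣ) n : (PadicAlgCl p)ˣ) : PadicAlgCl p)) := by
  rw [cyclotome.map_apply, MulEquiv.coe_toMonoidHom, coe_galUnits_apply]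

/-- **`H⁰(U, Ẑ(χ)) = 1` for `U ≤ G_{ℚ_p}` of finite index**: if `z ∈ Ẑ` satisfies `χ(σ) z = z` for every `σ ∈ U`,
then `z = 1` (`Ẑ` written multiplicatively).  Transport of abc-iut's `cyclotome_algClosure_eq_one_of_finiteIndex`
(`Λ(ℚ̄_pˣ)^U = 1`: the fixed field of `U` is a finite extension of `ℚ_p`, whose roots of unity form a finite group)
along `cycloZHat p`. [cite: NeukirchANT1999, Ch. II Prop. (5.7) (i)] -/
theorem eq_one_of_forall_chi_apply_eq (U : Subgroup (GQp p)) [U.FiniteIndex]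
    {z : completion (GrpCat.of (Multiplicative ℤ))} (hz : ∀ σ ∈ U, chi p σ z = z) : z = 1 := by
  set ζ : cyclotome (PadicAlgCl p)ˣ := (cycloZHat p).symm z with hζ
  have hfix : ∀ σ ∈ U, cyclotome.map (galUnits p σ).toMonoidHom ζ = ζ := fun σ hσ => by
    rw [hζ, ← cycloZHat_symm_chi, hz σ hσ]
  have h1 : ζ = 1 :=
    cyclotome_algClosure_eq_one_of_finiteIndex p ℚ_[p] U ζ fun σ hσ n => by
      conv_rhs => rw [← hfix σ hσ]
      exact (coe_map_galUnits_apply p σ ζ n).symm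
  calc z = cycloZHat p ζ := by rw [hζ, MulEquiv.apply_symm_apply]
    _ = 1 := by rw [h1, map_one]

/-- **`H⁰(U, Ẑ(χ)) = 1` for `U ≤ G_{ℚ_p}` OPEN** (open subgroups of the compact `G_{ℚ_p}` have finite index).
[cite: NeukirchANT1999, Ch. II Prop. (5.7) (i)] -/
theorem eq_one_of_forall_chi_apply_eq_of_isOpen (U : Subgroup (GQp p)) (hU : IsOpen (U : Set (GQp p)))
    {z : completion (GrpCat.of (Multiplicative ℤ))} (hz : ∀ σ ∈ U, chi p σ z = z) : z = 1 := by
  haveI : Finite (GQp p ⧸ U) := Subgroup.quotient_finite_of_isOpen U hU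
  haveI : U.FiniteIndex := Subgroup.finiteIndex_of_finite_quotient
  exact eq_one_of_forall_chi_apply_eq p U hz

/-- In particular **`H⁰(G_{ℚ_p}, Ẑ(χ)) = 1`**: the only `z ∈ Ẑ` fixed by `χ(σ)` for all `σ` is `z = 1`.
[cite: NeukirchANT1999, Ch. II Prop. (5.7) (i)] -/
theorem eq_one_of_forall_chi_apply_eq_top {z : completion (GrpCat.of (Multiplicative ℤ))}
    (hz : ∀ σ : GQp p, chi p σ z = z) : z = 1 :=
  eq_one_of_forall_chi_apply_eq p ⊤ fun σ _ => hz σ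

end Literature.AnabelianGeometry.EtaleTheta.SettingModel

end
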